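import Literature.NumberTheory.LFunctions.ChebotarevDensityNumberField
import Literature.NumberTheory.LFunctions.PrimeIdealTheorem
import HarnessLib

/-!
# Chebotarev's density theorem in NATURAL-density (prime-counting) form (Serre 1981, §2.1, Thm. 1)

Topic `NumberTheory/LFunctions`; namespace `Literature.NumberTheory.LFunctions.Chebotarev` (that of
`ChebotarevDensity` / `ChebotarevDensityNumberField`). ONE named fact (D-0014, statement only) and
its unfolding lemma.

The tree has Chebotarev's theorem in DIRICHLET-density form (`Chebotarev.HasChebotarevDensities`,
Neukirch VII (13.4); `Chebotarev.dirichletDensity_eq`, the `Γ_ℚ`-form; strong Dirichlet densities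
`HasStrongDirichletDensity`), the existence form for Artin representations
(`Automorphic.chebotarev_artinRep`, proved), and an unconditional natural-density UPPER bound
(`ChebotarevNaturalUpperBoundProofs`, whose docstring records: "Chebotarev's theorem in
*natural*-density form (`π_C(x) ∼ (#C/#G) π(x)`, Serre 1981, §2.1, Thm. 1 with eq. (9)) is not in
the tree"). This file vendors exactly that statement.

## Source (read 2026-08-15, page-level)

J.-P. Serre, *Quelques applications du théorème de densité de Chebotarev*, Publ. Math. IHÉS 54
(1981), §2.1 (printed p. 331 of the volume; p. 10 of the article PDF):
for a finite Galois extension `E/K` of number fields with group `G`, `V(E/K)` the set of places of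
`K` ramified in `E`, `C ⊆ G` "une partie de `G` stable par conjugaison", and
`S_C = {v ∈ Σ_K − V(E/K) : σ_v ∈ C}`:
"**Théorème 1.** — L'ensemble `S_C` est de densité `|C|/|G|` dans `Σ_K`." with the definition
immediately following: "Si `x ≥ 2`, notons `π_K(x)` (resp. `π_C(x)`) le nombre des places
`v ∈ Σ_K` (resp. `v ∈ S_C`) telles que `Nv ≤ x` … Dire que `S_C` est de densité `λ = |C|/|G|`
signifie que `lim_{x→∞} π_C(x)/π_K(x) = λ`, autrement dit que (9)
`π_C(x) = λ x/log x + o(x/log x)` pour `x → ∞`" (the equivalence by the prime number theorem (8)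
`π_K(x) ∼ x/log x` for `K`, in the tree `NumberField.primeIdealTheorem`, proved as
`primeIdealTheorem_holds`). Attributed there to Chebotarev ("conjecturé par Frobenius [12], …
démontré par Chebotarev (cf. [1], [47])"); effective versions: Lagarias–Odlyzko 1977, §§3–9
(Serre's Théorèmes 2–4), NOT restated here.

## Rendering

* `S_C` is the tree's `Chebotarev.primesOfFrobIn K L C` (`ChebotarevDensityNumberField`): the
  non-zero primes `v` of `K` unramified in `L` all of whose arithmetic Frobenii (at all `Q ∣ v`)
  lie in `C` — for `C` stable under conjugation and `v` unramified these Frobenii form one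
  conjugacy class, so this is Serre's "`σ_v ∈ C`" (`mem_primesOfFrobIn_iff_exists`).
* `π_K(x)` is the tree's `NumberField.primeIdealCount K x` (`PrimeIdealTheorem`: non-zero prime
  ideals of `𝓞 K` of absolute norm `≤ x` = finite places `v` with `Nv ≤ x`); `π_C(x)` is the
  `ncard` of `{v ∈ S_C | Nv ≤ x}` (a finite set: finitely many ideals of bounded norm).
* The statement is the printed DEFINITION form `π_C(x)/π_K(x) → |C|/|G|` along `atTop`; the
  quotient has Lean's junk value `· / 0 = 0` only while `π_K(x) = 0`, i.e. for small `x`,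
  invisible along `atTop`. Conjugation-stability of `C` is the hypothesis
  `∀ g ∈ C, ∀ τ, τ * g * τ⁻¹ ∈ C`. Fields in `Type` (universe 0), as for the tree's other
  number-field facts (`primeIdealTheorem`, `ExtendedRiemannHypothesis`).
* NOT here: the `x/log x` form (9) and the `Li` form (immediate from the fact and
  `primeIdealTheorem_holds`, left to users), error terms (Lagarias–Odlyzko; under GRH Serre's
  Thm. 4), and the `Γ_K`-form over `absoluteGaloisGroup` (cf. `Chebotarev.frobPrimes`,
  `dirichletDensity_eq_of_hasChebotarevDensities` for the Dirichlet analogue of that passage).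
  Grounds the route item `Summit.Langlands.Langlands.Theses.GaloisWeightedBE.ChebotarevPrimeMeanSquare`
  (with log weights and `|tr σ(Frob_v)|²` summed class by class, `⟨χ_σ, χ_σ⟩ = 1`: prover's glue by
  partial summation).
-/

noncomputable section

open Filter IsDedekindDomain
open scoped NumberField Topology Classical

namespace Literature.NumberTheory.LFunctions

namespace Chebotarev

/-- **Natural Chebotarev densities for the Galois extension `L|K`** (the conclusion of Serre 1981,
§2.1, Théorème 1, as a predicate on the extension): for every conjugation-stable `C ⊆ G(L|K)`,
`π_C(x) / π_K(x) → |C|/|G|` as `x → ∞`, where `π_C(x) = #{v ∈ S_C : Nv ≤ x}` counts the primes of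
`K` unramified in `L` with Frobenius class in `C` and norm `≤ x` (`primesOfFrobIn K L C`) and
`π_K(x) = NumberField.primeIdealCount K x`. [cite: Serre1981, §2.1 Thm. 1 with (8)–(9) (p. 331)] -/
def HasNaturalChebotarevDensities (K L : Type*) [Field K] [Field L] [NumberField K]
    [NumberField L] [Algebra K L] [IsGalois K L] : Prop :=
  ∀ C : Set (L ≃ₐ[K] L), (∀ g ∈ C, ∀ τ : L ≃ₐ[K] L, τ * g * τ⁻¹ ∈ C) →
    Tendsto (fun x : ℝ =>
        (({v ∈ primesOfFrobIn K L C | (Ideal.absNorm v.asIdeal : ℝ) ≤ x}.ncard : ℝ) /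
          (NumberField.primeIdealCount K x : ℝ)))
      atTop (𝓝 ((Nat.card C : ℝ) / Nat.card (L ≃ₐ[K] L)))

/-- Unfolding lemma for `HasNaturalChebotarevDensities`. [folklore] -/
theorem hasNaturalChebotarevDensities_iff (K L : Type*) [Field K] [Field L] [NumberField K]
    [NumberField L] [Algebra K L] [IsGalois K L] :
    HasNaturalChebotarevDensities K L ↔
      ∀ C : Set (L ≃ₐ[K] L), (∀ g ∈ C, ∀ τ : L ≃ₐ[K] L, τ * g * τ⁻¹ ∈ C) →
        Tendsto (fun x : ℝ =>
            (({v ∈ primesOfFrobIn K L C | (Ideal.absNorm v.asIdeal : ℝ) ≤ x}.ncard : ℝ) /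
              (NumberField.primeIdealCount K x : ℝ)))
          atTop (𝓝 ((Nat.card C : ℝ) / Nat.card (L ≃ₐ[K] L))) :=
  Iff.rfl

/-- **Chebotarev's density theorem, natural-density form** (Chebotarev 1926; as stated in
Serre, Publ. Math. IHÉS 54 (1981), §2.1, Théorème 1, p. 331: "L'ensemble `S_C` est de densité
`|C|/|G|` dans `Σ_K`", densité meaning `lim_{x→∞} π_C(x)/π_K(x) = |C|/|G|`, equivalently (9)
`π_C(x) = (|C|/|G|) x/log x + o(x/log x)`). For EVERY finite Galois extension `L|K` of number
fields and every conjugation-stable `C ⊆ Gal(L|K)`: `HasNaturalChebotarevDensities K L`. Named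
fact (D-0014), statement only; it refines the tree's Dirichlet-density `HasChebotarevDensities`
(natural density ⇒ Dirichlet density, not conversely). Users take
`(h : chebotarev_naturalDensity)`. [cite: Serre1981, §2.1 Thm. 1 (p. 331)] -/
def chebotarev_naturalDensity : Prop :=
  ∀ (K L : Type) [Field K] [Field L] [NumberField K] [NumberField L] [Algebra K L]
    [IsGalois K L], HasNaturalChebotarevDensities K L

end Chebotarev

end Literature.NumberTheory.LFunctions

end
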